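import Summits.CriticalPhenomena.SAWScalingLimit.Theses.SAWLoopFugacityFlow
import Summits.CriticalPhenomena.SAWScalingLimit.Theorems.SAWSteinDefectAvoidanceLimitTransfer
import Summits.CriticalPhenomena.SAWScalingLimit.Theorems.AvoidanceLimit.Negative.AvoidanceLimitExponentRigidity
import Summits.CriticalPhenomena.SAWScalingLimit.Theorems.SAWLoopFugacityFlowAvoidanceLimitAnchorDefs
import Summits.CriticalPhenomena.SAWScalingLimit.Theorems.SAWLoopFugacityFlowAvoidanceLimitSawEndpoint
import Summits.CriticalPhenomena.SAWScalingLimit.Theorems.SAWLoopFugacityFlowAvoidanceLimitVitaliTransport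
import Literature.Probability.LatticeModels.DiluteLoopModel
import Literature.Probability.LatticeModels.DiluteLoopModelIsing
import Literature.Probability.LatticeModels.DiluteLoopModelAnalyticity
import Literature.Probability.RandomPlanarGeometry.HullSubdomainPullback
import Literature.Probability.RandomPlanarGeometry.JordanDomainProofs
import Literature.Probability.RandomPlanarGeometry.RestrictionHullsProofs
import Literature.Analysis.Complex.Montel

/-!
# Birth skeleton (`Lines/birth.lean`, BC3) for the crux `AvoidanceLimit` of route `SAWLoopFugacityFlow`
(items stmt-CriticalPhenomena-4981 ≡ stmt-CriticalPhenomena-10649)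

Crux: `Summit.CriticalPhenomena.SAWScalingLimit.Theses.SAWLoopFugacityFlow.AvoidanceLimit` (rank 2; its
rev-1 form stmt-CriticalPhenomena-4981, with the pulled-back hull written `φ.pullbackHull D'`, is the
live decl `…Theses.SAWSteinDefect.AvoidanceLimit`; the two are equivalent by `rfl` on the hull,
kernel-checked in `Theorems/SAWSteinDefectAvoidanceLimitTransfer.lean`). For every Dobrushin domain
`(D; a, b)`, hull subdomain `D'`, endpoint approximation, chordal uniformizer `φ`, pulled-back hull `A`
and restriction data `(Φ, d = Φ'_A(0))`: `P_δ(range γ_δ ⊆ closure D') → d^(5/8)` as `δ → 0+`.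

## The line = the ROUTE'S OWN two-layer plan, typed (definition `DiluteLoopModel` has landed)

Route header, TWO-LAYER PLAN: "AvoidanceLimit ⇐ IsingWindow → FugacityAnalyticity → AvoidanceLimit (k = 2;
IsingBoundaryRatio is the n = 1 instance inside IsingWindow's conclusion) … Vitali ⇒ `R_δ` converges
locally uniformly on `U` to an analytic `R`; identity theorem with the window ⇒ `R(n) = Φ'_A(0)^b(n)` on
`U`; at `n = 0`, `R_δ(0) = P_δ(γ ⊆ cl D')`". Both children were filed INFORMAL (stmt-CriticalPhenomena-5080,
-5063) "until the definition DiluteLoopModel lands". It has landed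
(`Literature/Probability/LatticeModels/DiluteLoopModel{,Ising,SAW,SAWLaw,Analyticity}.lean`), so the plan
is typed here, along the route's diagonal path `(n, w) = (t, t/2)`, `t ∈ [0, 1]`, at the tree's critical
fugacity `x_c(t, t/2) = DiluteLoopModel.criticalFugacity t (t/2)`, for the doubly normalised two-leg
boundary ratio `R_δ(t; D, D') = twoLeg(confined)/twoLeg(Ω_δ)` (`DiluteLoopModel.boundaryRatio`) whose
numerator lives on the CONFINED graph `confinedGraph D D' δ` (edges of `Ω_δ` whose closed segment stays
in `closure D'`, landed `Theorems/…AnchorDefs.lean`) with the common volume `meshDomainFinset D δ` — the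
choice that makes the `n = 0` end EXACT (Disproof.lean cycle 2, attack 6: `{range ⊆ closure D'}` = "`γ_δ`
is a SAW of the subgraph of `Ω_δ` spanned by the closed edges inside `closure D'`"; landed
`Anchor.stub_sawEndpoint`, p90984) and at `(t, w, x) = (1, ½, tanh β_c)` is the free critical Ising
boundary two-point ratio on the confined graph (`DiluteLoopModel.twoLeg_one_half_tanh_eq_isingTwoPoint`),
i.e. the typed anchor `IsingBoundaryRatio` up to the microscopic boundary row on `∂D' ∩ D`.

Registered stubs (3):

* `stub_isingWindow` — IsingWindow (stmt-CriticalPhenomena-5080) TYPED; XL, the HARDEST (the bet of the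
  route: a constructive fermionic-RG window at the `ℤ²`-Ising free fermion, made local by oriented loops
  with turning phases; CGG arXiv:2408.12923, GGM doi:10.1063/1.4745910): there is `ε₀ ∈ (0, 1]` with
  `lim_{δ→0+} R_δ(t) = d^{bExp t}` for every `t ∈ (1 - ε₀, 1]` and every hull datum; `bExp 1 = 1/2`.
* `stub_fugacityAnalyticity` — FugacityAnalyticity (stmt-CriticalPhenomena-5063) TYPED; L–XL (Lee–Yang type
  zero-freeness of `Z_n(Ω_δ; ∅)`, `Z_n(Ω_δ; a, b)`, `Z_n^{conf}(∅)` in complex `n` near `[0, 1]`, UNIFORM in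
  the mesh — per mesh it is automatic, `DiluteLoopModel.exists_isOpen_differentiableOn_diag_domainBoundaryRatio`):
  a preconnected open `U ⊇ [0, 1]` in the strip `-2 < Re z < 2`, a holomorphic fugacity curve `Xc` on `U`
  extending `x_c(t, t/2)`, and for every hull geometry `δ`-uniform holomorphy and boundedness of
  `z ↦ R_δ(z)` on `U`.
* `stub_sawCriticalFugacity` — `x_c(0, 0) = 1/μ(ℤ²)` for the tree's boundedness-of-`χ_N` convention
  (half-plane and plane SAW share the connective constant: bridges `b_k ≤ h⁺_k ≤ c_k`, Hammersley–Welsh;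
  M, provable now — twin of the landed `Anchor.stub_sawCriticalPoint` for `xcDim`).

PROVED here (no `sorry`): `vitaliTransportUnit` (Vitali–Porter + identity theorem transport of `d^{bExp}`
from a window below `t = 1` to `t = 0` on a `U ⊇ [0, 1]` — the landed `Anchor.stub_vitaliTransport` is the
`[-2+η, 0]` twin; same proof), `ofReal_diag_boundaryRatio`, `eventually_good`, `isHullSubdomain_of_ball`,
and the composition `AvoidanceLimit_of : stub_isingWindow → stub_fugacityAnalyticity →
stub_sawCriticalFugacity → AvoidanceLimit` (window on `(1-ε₀, 1)` ⇒ pointwise limits of the holomorphic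
family ⇒ Vitali to `t = 0` (`0 < d`: the pulled-back hull under a CHORDAL `φ` is a `*`-hull) ⇒ at
`(0, 0, x_c)` the ratio is `Rδ 0 0 x_c` (`Rδ_dimerFugacity_zero`) = the avoidance probability
(`Anchor.stub_sawEndpoint`), eventually along the endpoint approximation). `AvoidanceLimit_of_steinDefect`
concludes the rev-1 decl of stmt-4981 through the landed transfer.

## Disproof.lean (cdisprove cycles 1–2) honoured

`avoidanceLimit_false_without_chordal` / `_without_hullEq` / `_without_normalisation` / `_without_deriv`:
the chordal `φ`, the hull identification and both normalisations of `Φ_A` are USED — in the glue for `0 < d`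
(`IsStarHull.pullbackHull`, `HasRestrictionDeriv.unique`) and in `stub_isingWindow`, whose value `d^{b(t)}`
is pinned by honest restriction data only; `_without_reachable`: reachability is used in `eventually_good`
(laws are probability measures, `a_δ ≠ b_δ`, `δ > 0` eventually); the ε-ball clause is kept verbatim in
every stub (near-miss `WithoutBall`). Exponent rigidity (`avoidanceLimit_not_exp`, landed Negative lemma,
imported and checked below): `5/8` enters as `bExp 0`, the Coulomb-gas exponent CONTINUED from the Ising
window (`bExp 1 = 1/2`), not as an exponent-blind covariance statement. No stub is an instance of a landed
Negative lemma (none drops a clause of the crux).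

Sources: Nienhuis1982; Blöte–Nienhuis doi:10.1088/0305-4470/22/9/028; Guo–Blöte–Nienhuis
arXiv:cond-mat/9812269; Cardy2005SLE §5.3 (`b = (6-κ)/(2κ)`, `n = -2cos(4π/κ)`); CGG arXiv:2408.12923;
LawlerSchrammWerner2003Restriction (Thm 6.1, in tree `sle_restriction_eightThirds_holds`);
LawlerSchrammWerner2004SAW §4.1 Prediction 1; Conway1978 Ch. VII Thm 2.9 (Montel, in tree).
-/

noncomputable section

open scoped BigOperators Topology symmDiff Classical
open Filter Finset
open Literature.Probability.RandomPlanarGeometry Literature.Probability.LatticeModels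
open Summit.CriticalPhenomena.SAWScalingLimit.Theses.SAWLoopFugacityFlow (AvoidanceLimit)
open Summit.CriticalPhenomena.SAWScalingLimit.Theorems.AvoidanceLimit.Anchor
  (confinedGraph confinedGraph_le confinedGraph_le_zdGraph Rδ bExp bExp_zero bExp_one Rδ_dimerFugacity_zero)

namespace Summit.CriticalPhenomena.SAWScalingLimit.Cruxes.AvoidanceLimit.Birth

/-! ## 1. The statements of the line (over landed declarations only) -/

/-- **IsingWindow** (stmt-CriticalPhenomena-5080, typed; XL, the hardest). There is `ε₀ ∈ (0, 1]` such
that for every loop fugacity `t ∈ (1 - ε₀, 1]`, along the route's diagonal `(n, w, x) = (t, t/2, x_c(t, t/2))`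
and for every hull datum of the crux, the doubly normalised two-leg boundary ratio of the dilute
non-crossing loop model — numerator on the confined graph `confinedGraph D D' δ`, denominator on `Ω_δ`,
common volume `meshDomainFinset D δ` — converges as `δ → 0+` to `d ^ bExp t`, `bExp` the Coulomb-gas
boundary one-leg exponent of the dilute branch (`bExp 1 = 1/2`: at `t = 1` this is the free critical
Ising boundary two-point RATIO, `DiluteLoopModel.twoLeg_one_half_tanh_eq_isingTwoPoint`, the route's anchor
IsingBoundaryRatio up to the boundary row on `∂D' ∩ D`). Intended proof: Grassmann/HT-contour
representation of the oriented loop vertex model with turning phases `e^{±iα/4}`, `2cos α = t`, as a local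
perturbation of the `ℤ²`-Ising free fermion; marginal direction handled as a line of fixed points.
[cite: arXiv:2408.12923] [cite: doi:10.1063/1.4745910] [cite: Cardy2005SLE, §5.3] -/
def IsingWindow : Prop :=
  ∃ ε₀ : ℝ, 0 < ε₀ ∧ ε₀ ≤ 1 ∧ ∀ t ∈ Set.Ioc (1 - ε₀) (1 : ℝ),
    ∀ (D D' : DobrushinDomain) (a b : ℝ → Site 2), SAW.IsEndpointApprox D a b →
    D'.carrier ⊆ D.carrier → D'.pt 0 = D.pt 0 → D'.pt 1 = D.pt 1 →
    (∃ ε : ℝ, 0 < ε ∧ D'.carrier ∩ Metric.ball (D.pt 0) ε = D.carrier ∩ Metric.ball (D.pt 0) ε ∧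
      D'.carrier ∩ Metric.ball (D.pt 1) ε = D.carrier ∩ Metric.ball (D.pt 1) ε) →
    ∀ (φ : ConformalEquiv UpperHalfPlane.upperHalfPlaneSet D.carrier), D.IsChordalUniformizing φ →
    ∀ (A : Set ℂ), A = closure (UpperHalfPlane.upperHalfPlaneSet \
      {z | z ∈ UpperHalfPlane.upperHalfPlaneSet ∧ φ z ∈ D'.carrier}) →
    ∀ (Φ : ConformalEquiv (UpperHalfPlane.upperHalfPlaneSet \ A) UpperHalfPlane.upperHalfPlaneSet)
      (d : ℝ), IsRestrictionMap A Φ → HasRestrictionDeriv A Φ d →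
    Tendsto (fun δ => (⟨t, t / 2, (DiluteLoopModel.criticalFugacity t (t / 2)).toReal⟩ :
        DiluteLoopModel ℝ).boundaryRatio (confinedGraph D.carrier D'.carrier δ)
        (meshDomainFinset D.carrier δ) (discreteDomainGraph D.carrier δ) (meshDomainFinset D.carrier δ)
        (a δ) (b δ)) (𝓝[>] 0) (𝓝 (d ^ bExp t))

/-- **FugacityAnalyticity** (stmt-CriticalPhenomena-5063, typed; L–XL, Lee–Yang type). There are a
preconnected open `U` in the strip `-2 < Re z < 2` containing the real segment `[0, 1]` and a fugacity
curve `Xc` holomorphic on `U` with `Xc t = x_c(t, t/2)` at real `t ∈ [0, 1]`, such that for every hull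
geometry of the crux there are `δ₀ > 0` and ONE bound `M` with: for every mesh `δ ∈ (0, δ₀)` the complex
ratio `z ↦ R_δ(z) = boundaryRatio ⟨z, z/2, Xc z⟩ (confined) (Ω_δ)` is holomorphic on `U` and bounded by
`M` there. Per mesh, pole-freeness near `[0, 1]` is automatic
(`DiluteLoopModel.exists_isOpen_differentiableOn_diag_domainBoundaryRatio`); the content is the
UNIFORMITY in `δ` (zero-free region of `Z_z(Ω_δ; ∅)`, `Z_z(Ω_δ; a, b)`, `Z_z^{conf}(∅)` in complex `z`).
[cite: Jacobsen2009, p. 367 (complex loop fugacity)] [cite: doi:10.1088/0305-4470/22/9/028] -/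
def FugacityAnalyticity : Prop :=
  ∃ (U : Set ℂ) (Xc : ℂ → ℂ), IsOpen U ∧ IsPreconnected U ∧ U ⊆ {z : ℂ | -2 < z.re ∧ z.re < 2} ∧
    (∀ t : ℝ, t ∈ Set.Icc (0 : ℝ) 1 → (t : ℂ) ∈ U) ∧ DifferentiableOn ℂ Xc U ∧
    (∀ t : ℝ, t ∈ Set.Icc (0 : ℝ) 1 →
      Xc t = (((DiluteLoopModel.criticalFugacity t (t / 2)).toReal : ℝ) : ℂ)) ∧
    ∀ (D D' : DobrushinDomain) (a b : ℝ → Site 2), SAW.IsEndpointApprox D a b →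
      D'.carrier ⊆ D.carrier → D'.pt 0 = D.pt 0 → D'.pt 1 = D.pt 1 →
      (∃ ε : ℝ, 0 < ε ∧ D'.carrier ∩ Metric.ball (D.pt 0) ε = D.carrier ∩ Metric.ball (D.pt 0) ε ∧
        D'.carrier ∩ Metric.ball (D.pt 1) ε = D.carrier ∩ Metric.ball (D.pt 1) ε) →
      ∃ δ₀ : ℝ, 0 < δ₀ ∧ ∃ M : ℝ, ∀ δ ∈ Set.Ioo (0 : ℝ) δ₀,
        DifferentiableOn ℂ (fun z : ℂ => (⟨z, z / 2, Xc z⟩ : DiluteLoopModel ℂ).boundaryRatio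
            (confinedGraph D.carrier D'.carrier δ) (meshDomainFinset D.carrier δ)
            (discreteDomainGraph D.carrier δ) (meshDomainFinset D.carrier δ) (a δ) (b δ)) U ∧
        ∀ z ∈ U, ‖(⟨z, z / 2, Xc z⟩ : DiluteLoopModel ℂ).boundaryRatio
            (confinedGraph D.carrier D'.carrier δ) (meshDomainFinset D.carrier δ)
            (discreteDomainGraph D.carrier δ) (meshDomainFinset D.carrier δ) (a δ) (b δ)‖ ≤ M

/-- **SAWCriticalFugacity** (known, M, provable now from the tree's Hammersley–Welsh / bridge bounds):
the tree's critical fugacity of the dilute loop model at the SAW corner is `1/μ(ℤ²)`,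
`DiluteLoopModel.criticalFugacity 0 0 = ofReal SAW.criticalFugacity`. At `(0, 0, x)` the half-plane
two-leg susceptibility of the box `Λ_N` is `Σ x^{|ω|}` over self-avoiding walks from `0` inside
`[-N, N] × [0, N]`: bounded in `N` for `x < 1/μ` (`c_k x^k` summable), unbounded for `x > 1/μ` (bridges
of length `≤ N` stay in `Λ_N`, `b_k ≥ μ^k e^{-c√k}`), so the `sSup` is `ofReal (1/μ)` whatever happens AT
`1/μ`. [cite: MadrasSlade1993, §3.1] [cite: LawlerSchrammWerner2004SAW, §3.1] -/
def SAWCriticalFugacity : Prop :=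
  DiluteLoopModel.criticalFugacity 0 0 = ENNReal.ofReal SAW.criticalFugacity

/-! ## 2. Registered stubs -/

/-! The `stub_*` theorems are the registered obligations (sorried; statements LITERAL so that the
registered signatures are self-contained); `Registered.stub_*` are the name-keyed `abbrev` aliases of
their statements, used as the hypotheses of `AvoidanceLimit_of` (the skeleton audit admits a hypothesis
whose head's last name component is a declared stub). -/
namespace Registered

abbrev stub_isingWindow : Prop := IsingWindow
abbrev stub_fugacityAnalyticity : Prop := FugacityAnalyticity
abbrev stub_sawCriticalFugacity : Prop := SAWCriticalFugacity

end Registered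

/-- STUB 1 (XL, HARDEST — the bet of the route): the Ising window (`IsingWindow`, literal). -/
theorem stub_isingWindow :
    ∃ ε₀ : ℝ, 0 < ε₀ ∧ ε₀ ≤ 1 ∧ ∀ t ∈ Set.Ioc (1 - ε₀) (1 : ℝ),
      ∀ (D D' : DobrushinDomain) (a b : ℝ → Site 2), SAW.IsEndpointApprox D a b →
      D'.carrier ⊆ D.carrier → D'.pt 0 = D.pt 0 → D'.pt 1 = D.pt 1 →
      (∃ ε : ℝ, 0 < ε ∧ D'.carrier ∩ Metric.ball (D.pt 0) ε = D.carrier ∩ Metric.ball (D.pt 0) ε ∧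
        D'.carrier ∩ Metric.ball (D.pt 1) ε = D.carrier ∩ Metric.ball (D.pt 1) ε) →
      ∀ (φ : ConformalEquiv UpperHalfPlane.upperHalfPlaneSet D.carrier), D.IsChordalUniformizing φ →
      ∀ (A : Set ℂ), A = closure (UpperHalfPlane.upperHalfPlaneSet \
        {z | z ∈ UpperHalfPlane.upperHalfPlaneSet ∧ φ z ∈ D'.carrier}) →
      ∀ (Φ : ConformalEquiv (UpperHalfPlane.upperHalfPlaneSet \ A) UpperHalfPlane.upperHalfPlaneSet)
        (d : ℝ), IsRestrictionMap A Φ → HasRestrictionDeriv A Φ d →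
      Tendsto (fun δ => (⟨t, t / 2, (DiluteLoopModel.criticalFugacity t (t / 2)).toReal⟩ :
          DiluteLoopModel ℝ).boundaryRatio (confinedGraph D.carrier D'.carrier δ)
          (meshDomainFinset D.carrier δ) (discreteDomainGraph D.carrier δ) (meshDomainFinset D.carrier δ)
          (a δ) (b δ)) (𝓝[>] 0) (𝓝 (d ^ bExp t)) := by
  sorry

/-- STUB 2 (L–XL): `δ`-uniform analytic continuation in the loop fugacity near `[0, 1]`
(`FugacityAnalyticity`, literal). -/
theorem stub_fugacityAnalyticity :
    ∃ (U : Set ℂ) (Xc : ℂ → ℂ), IsOpen U ∧ IsPreconnected U ∧ U ⊆ {z : ℂ | -2 < z.re ∧ z.re < 2} ∧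
      (∀ t : ℝ, t ∈ Set.Icc (0 : ℝ) 1 → (t : ℂ) ∈ U) ∧ DifferentiableOn ℂ Xc U ∧
      (∀ t : ℝ, t ∈ Set.Icc (0 : ℝ) 1 →
        Xc t = (((DiluteLoopModel.criticalFugacity t (t / 2)).toReal : ℝ) : ℂ)) ∧
      ∀ (D D' : DobrushinDomain) (a b : ℝ → Site 2), SAW.IsEndpointApprox D a b →
        D'.carrier ⊆ D.carrier → D'.pt 0 = D.pt 0 → D'.pt 1 = D.pt 1 →
        (∃ ε : ℝ, 0 < ε ∧ D'.carrier ∩ Metric.ball (D.pt 0) ε = D.carrier ∩ Metric.ball (D.pt 0) ε ∧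
          D'.carrier ∩ Metric.ball (D.pt 1) ε = D.carrier ∩ Metric.ball (D.pt 1) ε) →
        ∃ δ₀ : ℝ, 0 < δ₀ ∧ ∃ M : ℝ, ∀ δ ∈ Set.Ioo (0 : ℝ) δ₀,
          DifferentiableOn ℂ (fun z : ℂ => (⟨z, z / 2, Xc z⟩ : DiluteLoopModel ℂ).boundaryRatio
              (confinedGraph D.carrier D'.carrier δ) (meshDomainFinset D.carrier δ)
              (discreteDomainGraph D.carrier δ) (meshDomainFinset D.carrier δ) (a δ) (b δ)) U ∧
          ∀ z ∈ U, ‖(⟨z, z / 2, Xc z⟩ : DiluteLoopModel ℂ).boundaryRatio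
              (confinedGraph D.carrier D'.carrier δ) (meshDomainFinset D.carrier δ)
              (discreteDomainGraph D.carrier δ) (meshDomainFinset D.carrier δ) (a δ) (b δ)‖ ≤ M := by
  sorry

/-- STUB 3 (M, provable now): `x_c(0, 0) = 1/μ` for the tree's convention (`SAWCriticalFugacity`, literal). -/
theorem stub_sawCriticalFugacity :
    DiluteLoopModel.criticalFugacity 0 0 = ENNReal.ofReal SAW.criticalFugacity := by
  sorry

/-! The literal stubs are, by `Iff.rfl`, the named statements of §1. -/
example : IsingWindow := stub_isingWindow
example : FugacityAnalyticity := stub_fugacityAnalyticity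
example : SAWCriticalFugacity := stub_sawCriticalFugacity

/-! ## 3. Glue (sorry-free) -/

/-! ### 3a. Vitali–Porter transport on `[0, 1]` (the `[-2+η, 0]` twin is the landed `Anchor.stub_vitaliTransport`) -/

/-- On the strip `-2 < Re z < 2` the quotient `(2 + z)/(2 - z)` avoids the closed negative real axis. -/
private theorem cayley_mem_slitPlane {z : ℂ} (h1 : -2 < z.re) (h2 : z.re < 2) :
    (2 + z) / (2 - z) ∈ Complex.slitPlane := by
  by_cases him : z.im = 0
  · have hz : z = ((z.re : ℝ) : ℂ) := Complex.ext (by simp) (by simp [him])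
    have hq : (2 + z) / (2 - z) = (((2 + z.re) / (2 - z.re) : ℝ) : ℂ) := by
      rw [hz]; push_cast; rfl
    rw [hq, Complex.ofReal_mem_slitPlane]
    exact div_pos (by linarith) (by linarith)
  · rw [Complex.mem_slitPlane_iff]
    right
    have hn : 0 < Complex.normSq (2 - z) := by
      rw [Complex.normSq_pos]
      intro h
      have := congrArg Complex.re h
      simp at this
      linarith
    rw [Complex.div_im, div_sub_div_same]
    refine div_ne_zero ?_ hn.ne'
    simp only [Complex.add_im, Complex.sub_re, Complex.add_re, Complex.sub_im]
    norm_num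
    intro h
    apply him
    nlinarith [h]

/-- The principal square root of a point off the closed negative real axis has positive real part. -/
private theorem re_cpow_inv_two_pos {q : ℂ} (hq : q ∈ Complex.slitPlane) :
    0 < (q ^ (2⁻¹ : ℂ)).re := by
  rw [Complex.cpow_inv_two_re]
  apply Real.sqrt_pos.2
  have : 0 < ‖q‖ + q.re := by
    rcases Complex.mem_slitPlane_iff.1 hq with h | h
    · linarith [norm_nonneg q]
    · have := Complex.abs_re_lt_norm.2 h
      linarith [neg_abs_le q.re]
  linarith

/-- `Complex.arctan` is complex differentiable at every `w` with `Re w > 0`. -/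
private theorem differentiableAt_arctan_of_re_pos {w : ℂ} (hw : 0 < w.re) :
    DifferentiableAt ℂ Complex.arctan w := by
  have hn : 0 < Complex.normSq (1 - w * Complex.I) := by
    rw [Complex.normSq_pos]
    intro h
    have := congrArg Complex.im h
    simp at this
    linarith
  have h1 : (1 : ℂ) - w * Complex.I ≠ 0 := Complex.normSq_pos.1 hn
  have h2 : (1 + w * Complex.I) / (1 - w * Complex.I) ∈ Complex.slitPlane := by
    rw [Complex.mem_slitPlane_iff]
    right
    rw [Complex.div_im, div_sub_div_same]
    refine div_ne_zero ?_ hn.ne'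
    simp only [Complex.add_im, Complex.one_im, Complex.mul_im, Complex.I_re, Complex.I_im,
      Complex.sub_re, Complex.one_re, Complex.mul_re, Complex.add_re, Complex.sub_im]
    norm_num
    intro h
    nlinarith [h]
  change DifferentiableAt ℂ
    (fun z : ℂ => -Complex.I / 2 * Complex.log ((1 + z * Complex.I) / (1 - z * Complex.I))) w
  have hdiv : DifferentiableAt ℂ (fun z : ℂ => (1 + z * Complex.I) / (1 - z * Complex.I)) w :=
    DifferentiableAt.div (by fun_prop) (by fun_prop) h1
  have hlog : DifferentiableAt ℂ
      (fun z : ℂ => Complex.log ((1 + z * Complex.I) / (1 - z * Complex.I))) w := hdiv.clog h2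
  exact hlog.const_mul _

/-- The explicit continuation `h(z) = d ^ (1 - 3·arctan(((2+z)/(2-z))^{1/2})/(2π))` of `s ↦ d ^ bExp s`
is complex differentiable on the strip `-2 < Re z < 2` (`d > 0`). -/
private theorem differentiableAt_continuation {d : ℝ} (hd : 0 < d) {z : ℂ} (h1 : -2 < z.re)
    (h2 : z.re < 2) :
    DifferentiableAt ℂ (fun z : ℂ => (d : ℂ) ^ ((1 : ℂ) -
      3 * Complex.arctan (((2 + z) / (2 - z)) ^ (2⁻¹ : ℂ)) / (2 * (Real.pi : ℂ)))) z := by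
  have hne : (2 : ℂ) - z ≠ 0 := by
    intro h
    have := congrArg Complex.re h
    simp at this
    linarith
  have hq : DifferentiableAt ℂ (fun z : ℂ => (2 + z) / (2 - z)) z :=
    DifferentiableAt.div (by fun_prop) (by fun_prop) hne
  have hsqrt : DifferentiableAt ℂ (fun z : ℂ => ((2 + z) / (2 - z)) ^ (2⁻¹ : ℂ)) z :=
    hq.cpow_const (cayley_mem_slitPlane h1 h2)
  have harc :=
    (differentiableAt_arctan_of_re_pos (re_cpow_inv_two_pos (cayley_mem_slitPlane h1 h2))).comp
      z hsqrt
  have hB := ((harc.const_mul 3).div_const (2 * (Real.pi : ℂ))).const_sub 1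
  exact hB.const_cpow (Or.inl (Complex.ofReal_ne_zero.2 hd.ne'))

/-- On the real segment `(-2, 2)` the continuation IS `d ^ bExp s`. -/
private theorem continuation_ofReal {d : ℝ} (hd : 0 < d) {s : ℝ} (h1 : -2 < s) (h2 : s < 2) :
    (d : ℂ) ^ ((1 : ℂ) - 3 * Complex.arctan (((2 + (s : ℂ)) / (2 - (s : ℂ))) ^ (2⁻¹ : ℂ)) /
      (2 * (Real.pi : ℂ))) = ((d ^ bExp s : ℝ) : ℂ) := by
  have hq : (0 : ℝ) ≤ (2 + s) / (2 - s) := div_nonneg (by linarith) (by linarith)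
  have hsqrt : ((2 + (s : ℂ)) / (2 - (s : ℂ))) ^ (2⁻¹ : ℂ) =
      ((Real.sqrt ((2 + s) / (2 - s)) : ℝ) : ℂ) := by
    rw [Real.sqrt_eq_rpow, Complex.ofReal_cpow hq]
    push_cast
    norm_num
  rw [Complex.ofReal_cpow hd.le, hsqrt, ← Complex.ofReal_arctan]
  congr 1
  simp only [bExp]
  push_cast
  ring

/-- **Vitali–Porter transport on `[0, 1]` (PROVED).** For a preconnected open `U ⊆ {-2 < Re z < 2}`
containing `[0, 1]`, a family `f δ` holomorphic on `U` and bounded by `M` there for `δ ∈ (0, δ₀)`, `d > 0`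
and `0 ≤ s₁ < s₂ ≤ 1`: if `f δ s → d ^ bExp s` as `δ → 0+` for every `s ∈ (s₁, s₂)`, then
`f δ 0 → d ^ (5/8)`. Subsequence principle + Montel (tree: `Complex.exists_strictMono_tendstoLocallyUniformlyOn_of_norm_le`)
+ identity theorem against the explicit continuation, and `bExp 0 = 5/8`. [cite: Conway1978, Ch. VII Thm. 2.9] -/
theorem vitaliTransportUnit (U : Set ℂ) (hUo : IsOpen U) (hUc : IsPreconnected U)
    (hUsub : U ⊆ {z : ℂ | -2 < z.re ∧ z.re < 2}) (hUI : ∀ s : ℝ, s ∈ Set.Icc (0 : ℝ) 1 → (s : ℂ) ∈ U)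
    (f : ℝ → ℂ → ℂ) (M δ₀ : ℝ) (hδ₀ : 0 < δ₀)
    (hf : ∀ δ ∈ Set.Ioo (0 : ℝ) δ₀, DifferentiableOn ℂ (f δ) U ∧ ∀ z ∈ U, ‖f δ z‖ ≤ M)
    (d : ℝ) (hd : 0 < d) (s₁ s₂ : ℝ) (hs₁ : 0 ≤ s₁) (hs₁₂ : s₁ < s₂) (hs₂ : s₂ ≤ 1)
    (hlim : ∀ s ∈ Set.Ioo s₁ s₂, Tendsto (fun δ => f δ s) (𝓝[>] 0) (𝓝 ((d ^ bExp s : ℝ) : ℂ))) :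
    Tendsto (fun δ => f δ 0) (𝓝[>] 0) (𝓝 ((d ^ ((5 : ℝ) / 8) : ℝ) : ℂ)) := by
  -- the explicit continuation `h` of `s ↦ d ^ bExp s`
  set h : ℂ → ℂ := fun z : ℂ => (d : ℂ) ^ ((1 : ℂ) -
    3 * Complex.arctan (((2 + z) / (2 - z)) ^ (2⁻¹ : ℂ)) / (2 * (Real.pi : ℂ))) with hh
  have hhU : DifferentiableOn ℂ h U := fun z hz =>
    (differentiableAt_continuation hd (hUsub hz).1 (hUsub hz).2).differentiableWithinAt
  have hh_real : ∀ s : ℝ, -2 < s → s < 2 → h s = ((d ^ bExp s : ℝ) : ℂ) := fun s h1 h2 =>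
    continuation_ofReal hd h1 h2
  have h0U : (0 : ℂ) ∈ U := by simpa using hUI 0 ⟨le_rfl, zero_le_one⟩
  have hh0 : h 0 = ((d ^ ((5 : ℝ) / 8) : ℝ) : ℂ) := by
    have := hh_real 0 (by norm_num) (by norm_num)
    rw [bExp_zero] at this
    simpa using this
  -- subsequence principle along `𝓝[>] 0`
  refine Filter.tendsto_of_subseq_tendsto fun δs hδs => ?_
  obtain ⟨N, hN⟩ : ∃ N, ∀ k ≥ N, δs k ∈ Set.Ioo 0 δ₀ :=
    eventually_atTop.1 (hδs.eventually (Ioo_mem_nhdsGT hδ₀))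
  have hN' : ∀ k, δs (k + N) ∈ Set.Ioo 0 δ₀ := fun k => hN (k + N) (Nat.le_add_left N k)
  -- Montel on the tail `k ↦ f (δs (k + N))`
  obtain ⟨g, φ, hφ, hgd, hgl, -⟩ :=
    Complex.exists_strictMono_tendstoLocallyUniformlyOn_of_norm_le hUo
      (F := fun k => f (δs (k + N))) (M := M) (fun k => (hf _ (hN' k)).1)
      (fun k z hz => (hf _ (hN' k)).2 z hz)
  have hsub : Tendsto (fun k => δs (φ k + N)) atTop (𝓝[>] 0) :=
    hδs.comp ((tendsto_add_atTop_nat N).comp hφ.tendsto_atTop)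
  -- the limit is `d ^ bExp s` on `(s₁, s₂)`
  have hg_real : ∀ s ∈ Set.Ioo s₁ s₂, g s = h s := by
    intro s hs
    have hsU : (s : ℂ) ∈ U := hUI s ⟨by linarith [hs.1], by linarith [hs.2]⟩
    have h1 : Tendsto (fun k => f (δs (φ k + N)) s) atTop (𝓝 (g s)) := hgl.tendsto_at hsU
    have h2 : Tendsto (fun k => f (δs (φ k + N)) s) atTop (𝓝 ((d ^ bExp s : ℝ) : ℂ)) :=
      (hlim s hs).comp hsub
    rw [tendsto_nhds_unique h1 h2, hh_real s (by linarith [hs.1]) (by linarith [hs.2])]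
  -- identity theorem: `g = h` on `U`
  have hgh : Set.EqOn g h U := by
    have hx₀ : (s₁ + s₂) / 2 ∈ Set.Ioo s₁ s₂ := ⟨by linarith, by linarith⟩
    have hz₀U : (((s₁ + s₂) / 2 : ℝ) : ℂ) ∈ U :=
      hUI _ ⟨by linarith [hx₀.1], by linarith [hx₀.2]⟩
    refine (hgd.analyticOnNhd hUo).eqOn_of_preconnected_of_frequently_eq (hhU.analyticOnNhd hUo)
      hUc hz₀U ?_
    have hmap : Tendsto (fun s : ℝ => (s : ℂ)) (𝓝[≠] ((s₁ + s₂) / 2))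
        (𝓝[≠] (((s₁ + s₂) / 2 : ℝ) : ℂ)) :=
      Complex.continuous_ofReal.continuousWithinAt.tendsto_nhdsWithin fun s hs => by
        simpa only [Set.mem_compl_iff, Set.mem_singleton_iff, Complex.ofReal_inj] using hs
    have hev : ∀ᶠ s : ℝ in 𝓝[≠] ((s₁ + s₂) / 2), g (s : ℂ) = h (s : ℂ) := by
      filter_upwards [mem_nhdsWithin_of_mem_nhds (Ioo_mem_nhds hx₀.1 hx₀.2)] with s hs
        using hg_real s hs
    exact hmap.frequently hev.frequently
  -- conclusion along the subsequence
  refine ⟨fun n => φ n + N, ?_⟩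
  have hlim0 : Tendsto (fun k => f (δs (φ k + N)) 0) atTop (𝓝 (g 0)) := hgl.tendsto_at h0U
  rw [hgh h0U, hh0] at hlim0
  exact hlim0

/-! ### 3b. Lattice bookkeeping -/

/-- Along an endpoint approximation, eventually `δ > 0`, `a_δ ≠ b_δ` and both legs lie in the volume
`meshDomainFinset D δ` (uses `IsEndpointApprox.reachable` — Disproof: reachability is load-bearing). -/
theorem eventually_good {D : DobrushinDomain} {a b : ℝ → Site 2} (hab : SAW.IsEndpointApprox D a b) :
    ∀ᶠ δ in 𝓝[>] (0 : ℝ), 0 < δ ∧ a δ ≠ b δ ∧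
      a δ ∈ meshDomainFinset D.carrier δ ∧ b δ ∈ meshDomainFinset D.carrier δ := by
  have h0 : ∀ᶠ δ in 𝓝[>] (0 : ℝ), 0 < δ := eventually_mem_nhdsWithin
  have hpq : D.pt 0 ≠ D.pt 1 := fun h => absurd (D.pt_injective h) (by decide)
  have hr : 0 < dist (D.pt 0) (D.pt 1) / 2 := by
    have := dist_pos.2 hpq
    positivity
  have ha := (Metric.tendsto_nhds.1 hab.tendsto_fst) _ hr
  have hb := (Metric.tendsto_nhds.1 hab.tendsto_snd) _ hr
  have hne : ∀ᶠ δ in 𝓝[>] (0 : ℝ), a δ ≠ b δ := by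
    filter_upwards [ha, hb] with δ hδa hδb heq
    rw [heq] at hδa
    have h3 := dist_triangle (D.pt 0) (meshPoint δ (b δ)) (D.pt 1)
    rw [dist_comm] at hδa
    linarith
  filter_upwards [h0, hne, hab.reachable] with δ hδ hne hreach
  obtain ⟨p⟩ := hreach
  obtain ⟨w, hadj, -, -⟩ := p.exists_eq_cons_of_ne hne
  obtain ⟨w', hadj', -, -⟩ := p.reverse.exists_eq_cons_of_ne hne.symm
  have hD : Bornology.IsBounded D.carrier := D.isBounded
  have hmem : ∀ v, v ∈ meshDomain D.carrier δ → v ∈ meshDomainFinset D.carrier δ := fun v hv => by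
    rw [← Finset.mem_coe, coe_meshDomainFinset hD hδ]
    exact hv
  exact ⟨hδ, hne, hmem _ (discreteDomainGraph_adj_iff.1 hadj).2.1,
    hmem _ (discreteDomainGraph_adj_iff.1 hadj').2.1⟩

/-- The inline hull hypotheses of the crux give the tree's `IsHullSubdomain` (ball agreement ⇒ the
marked points are off `closure (D ∖ D')`). -/
theorem isHullSubdomain_of_ball {D D' : DobrushinDomain} (hsub : D'.carrier ⊆ D.carrier)
    (h0 : D'.pt 0 = D.pt 0) (h1 : D'.pt 1 = D.pt 1)
    (hball : ∃ ε : ℝ, 0 < ε ∧ D'.carrier ∩ Metric.ball (D.pt 0) ε = D.carrier ∩ Metric.ball (D.pt 0) ε ∧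
      D'.carrier ∩ Metric.ball (D.pt 1) ε = D.carrier ∩ Metric.ball (D.pt 1) ε) :
    D.IsHullSubdomain D' := by
  obtain ⟨ε, hε, hb0, hb1⟩ := hball
  have key : ∀ p : ℂ, D'.carrier ∩ Metric.ball p ε = D.carrier ∩ Metric.ball p ε →
      p ∉ closure (D.carrier \ D'.carrier) := by
    intro p hp hmem
    rw [mem_closure_iff_nhds] at hmem
    obtain ⟨z, hzb, hzD, hzD'⟩ := hmem (Metric.ball p ε) (Metric.ball_mem_nhds p hε)
    have hz : z ∈ D'.carrier ∩ Metric.ball p ε := by rw [hp]; exact ⟨hzD, hzb⟩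
    exact hzD' hz.1
  exact ⟨hsub, h0, h1, key _ hb0, key _ hb1⟩

/-- **The real diagonal ratio, seen in `ℂ`, is the complex diagonal ratio at the real point** (bridge
between the real window statement and the complex continuation statement; cf. the tree's
`DiluteLoopModel.ofReal_diag_domainBoundaryRatio`). -/
theorem ofReal_diag_boundaryRatio (t x : ℝ) (G' : SimpleGraph (Site 2)) [G'.LocallyFinite]
    (Λ' : Finset (Site 2)) (G : SimpleGraph (Site 2)) [G.LocallyFinite] (Λ : Finset (Site 2))
    (u v : Site 2) :
    (((⟨t, t / 2, x⟩ : DiluteLoopModel ℝ).boundaryRatio G' Λ' G Λ u v : ℝ) : ℂ) =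
      (⟨(t : ℂ), (t : ℂ) / 2, (x : ℂ)⟩ : DiluteLoopModel ℂ).boundaryRatio G' Λ' G Λ u v := by
  rw [← Complex.ofRealHom_eq_coe, DiluteLoopModel.map_boundaryRatio]
  simp [DiluteLoopModel.map, Complex.ofRealHom_eq_coe]

/-! ## 4. The composition: the registered stubs imply the crux, BY NAME -/

/-- **`AvoidanceLimit_of` (kernel-checked, no `sorry` here): IsingWindow → FugacityAnalyticity →
SAWCriticalFugacity → `SAWLoopFugacityFlow.AvoidanceLimit`.** Window (S1) on `(1 - ε₀, 1)` gives the
pointwise limits `d^{bExp t}` of the real ratios; they are the real points of the holomorphic, `δ`-uniformly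
bounded family of S2 (`ofReal_diag_boundaryRatio`, `Xc t = x_c(t, t/2)`); `0 < d` because the pulled-back
hull under a CHORDAL `φ` is a `*`-hull (`IsStarHull.pullbackHull`, `HasRestrictionDeriv.unique`); the
PROVED Vitali transport carries `d^{bExp}` to `t = 0`: `R_δ(0) → d^{5/8}`; at `(0, 0, x_c)` (S3 pins
`x_c(0,0) = 1/μ`) the ratio is `Rδ 0 0 x_c` (`Rδ_dimerFugacity_zero`), which IS the avoidance probability
(landed `Anchor.stub_sawEndpoint`), eventually along the endpoint approximation (`eventually_good`). -/
theorem AvoidanceLimit_of (h1 : Registered.stub_isingWindow) (h2 : Registered.stub_fugacityAnalyticity)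
    (h3 : Registered.stub_sawCriticalFugacity) : AvoidanceLimit := by
  intro D D' a b hab hsub hp0 hp1 hball φ hφ A hA Φ d hΦ hd
  -- (0) `0 < d`: the pulled-back hull of a hull subdomain under a CHORDAL uniformizer is a `*`-hull.
  have hHull : D.IsHullSubdomain D' := isHullSubdomain_of_ball hsub hp0 hp1 hball
  have hstar : IsStarHull A := by
    rw [hA]
    exact IsStarHull.pullbackHull JordanDomain.isSimplyConnected_holds hφ hHull
  obtain ⟨d', hd'0, -, hd'⟩ := IsStarHull.exists_hasRestrictionDeriv_holds hstar hΦ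
  have hdpos : 0 < d := by rwa [hd.unique hstar hd']
  -- (1) the window, (2) the continuation
  obtain ⟨ε₀, hε₀, hε₁, hW⟩ := h1
  obtain ⟨U, Xc, hUo, hUc, hUstrip, hUseg, -, hXreal, hB⟩ := h2
  obtain ⟨δ₀, hδ₀, M, hFM⟩ := hB D D' a b hab hsub hp0 hp1 hball
  -- the family to transport
  set f : ℝ → ℂ → ℂ := fun δ z => (⟨z, z / 2, Xc z⟩ : DiluteLoopModel ℂ).boundaryRatio
      (confinedGraph D.carrier D'.carrier δ) (meshDomainFinset D.carrier δ)
      (discreteDomainGraph D.carrier δ) (meshDomainFinset D.carrier δ) (a δ) (b δ) with hf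
  have hreal : ∀ t : ℝ, t ∈ Set.Icc (0 : ℝ) 1 → ∀ δ,
      f δ t = (((⟨t, t / 2, (DiluteLoopModel.criticalFugacity t (t / 2)).toReal⟩ :
        DiluteLoopModel ℝ).boundaryRatio (confinedGraph D.carrier D'.carrier δ)
        (meshDomainFinset D.carrier δ) (discreteDomainGraph D.carrier δ) (meshDomainFinset D.carrier δ)
        (a δ) (b δ) : ℝ) : ℂ) := by
    intro t ht δ
    simp only [hf]
    rw [hXreal t ht, ofReal_diag_boundaryRatio]
  -- (3) pointwise limits on the overlap `(1 - ε₀, 1)` from the window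
  have hlim : ∀ s ∈ Set.Ioo (1 - ε₀) 1,
      Tendsto (fun δ => f δ s) (𝓝[>] 0) (𝓝 ((d ^ bExp s : ℝ) : ℂ)) := by
    intro s hs
    have hs01 : s ∈ Set.Icc (0 : ℝ) 1 := ⟨by linarith [hs.1], hs.2.le⟩
    have hw := hW s ⟨hs.1, hs.2.le⟩ D D' a b hab hsub hp0 hp1 hball φ hφ A hA Φ d hΦ hd
    have hfun : (fun δ => f δ s) = fun δ =>
        (((⟨s, s / 2, (DiluteLoopModel.criticalFugacity s (s / 2)).toReal⟩ :
          DiluteLoopModel ℝ).boundaryRatio (confinedGraph D.carrier D'.carrier δ)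
          (meshDomainFinset D.carrier δ) (discreteDomainGraph D.carrier δ) (meshDomainFinset D.carrier δ)
          (a δ) (b δ) : ℝ) : ℂ) :=
      funext (hreal s hs01)
    rw [hfun]
    exact (Complex.continuous_ofReal.tendsto _).comp hw
  -- (4) Vitali transport to `0` (PROVED above)
  have key := vitaliTransportUnit U hUo hUc hUstrip hUseg f M δ₀ hδ₀ hFM d hdpos (1 - ε₀) 1
    (by linarith) (by linarith) le_rfl hlim
  -- (5) at `0` the curve is the SAW point and the ratio is `Rδ 0 0 x_c`
  have hμ : 0 ≤ SAW.criticalFugacity :=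
    inv_nonneg.2 (Real.iInf_nonneg fun n => Real.rpow_nonneg (Nat.cast_nonneg _) _)
  have hxc : (DiluteLoopModel.criticalFugacity 0 0).toReal = SAW.criticalFugacity := by
    have h3' : DiluteLoopModel.criticalFugacity 0 0 = ENNReal.ofReal SAW.criticalFugacity := h3
    rw [h3', ENNReal.toReal_ofReal hμ]
  have hf0 : ∀ δ, f δ 0 =
      ((Rδ (0 : ℝ) 0 SAW.criticalFugacity D.carrier D'.carrier δ (a δ) (b δ) : ℝ) : ℂ) := by
    intro δ
    have h := hreal 0 ⟨le_rfl, zero_le_one⟩ δ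
    simp only [zero_div, Complex.ofReal_zero] at h
    rw [hxc] at h
    rw [Rδ_dimerFugacity_zero]
    exact h
  have hC : Tendsto (fun δ => ((Rδ (0 : ℝ) 0 SAW.criticalFugacity D.carrier D'.carrier δ (a δ) (b δ) : ℝ) : ℂ))
      (𝓝[>] 0) (𝓝 ((d ^ ((5 : ℝ) / 8) : ℝ) : ℂ)) := by
    have hfun : (fun δ => f δ 0) =
        fun δ => ((Rδ (0 : ℝ) 0 SAW.criticalFugacity D.carrier D'.carrier δ (a δ) (b δ) : ℝ) : ℂ) :=
      funext hf0
    rw [← hfun]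
    exact key
  have hR : Tendsto (fun δ => Rδ (0 : ℝ) 0 SAW.criticalFugacity D.carrier D'.carrier δ (a δ) (b δ))
      (𝓝[>] 0) (𝓝 (d ^ ((5 : ℝ) / 8))) := by
    have h := (Complex.continuous_re.tendsto _).comp hC
    rw [Complex.ofReal_re] at h
    exact h.congr' (Eventually.of_forall fun δ => Complex.ofReal_re _)
  -- (6) the ratio at `(0, 0, x_c)` is the avoidance probability, eventually in `δ`
  refine (ENNReal.tendsto_ofReal hR).congr' ?_
  filter_upwards [eventually_good hab] with δ hδ
  exact (Theorems.AvoidanceLimit.Anchor.stub_sawEndpoint D.carrier D'.carrier δ (a δ) (b δ) D.isBounded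
    hδ.1 hδ.2.1).symm

/-- **The same skeleton concludes the rev-1 decl of stmt-CriticalPhenomena-4981** (route SAWSteinDefect's
`AvoidanceLimit`, hull written `φ.pullbackHull D'`), through the landed transfer
`Theorems.AvoidanceLimit.steinDefect_of_loopFugacityFlow` (`rfl` on the hull). -/
theorem AvoidanceLimit_of_steinDefect (h1 : Registered.stub_isingWindow)
    (h2 : Registered.stub_fugacityAnalyticity) (h3 : Registered.stub_sawCriticalFugacity) :
    Summit.CriticalPhenomena.SAWScalingLimit.Theses.SAWSteinDefect.AvoidanceLimit :=
  Theorems.AvoidanceLimit.steinDefect_of_loopFugacityFlow (AvoidanceLimit_of h1 h2 h3)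

/-- Hypothesis-free form: the crux modulo the three sorried stubs. -/
example : AvoidanceLimit :=
  AvoidanceLimit_of stub_isingWindow stub_fugacityAnalyticity stub_sawCriticalFugacity

/-! ## 5. Checks against the landed `Negative/` lemmas (imported) -/

/-- The value the line produces is THE exponent of the crux family: `5/8 = bExp 0` is continued from the
Ising anchor value `bExp 1 = 1/2`, and the crux excludes every other exponent (`avoidanceLimit_not_exp`):
not an exponent-blind covariance statement. -/
example : bExp 0 = 5 / 8 ∧ bExp 1 = 1 / 2 ∧
    (AvoidanceLimit → ¬ Theorems.AvoidanceLimit.Negative.AvoidanceLimitExp ((1 : ℝ) / 2)) :=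
  ⟨bExp_zero, bExp_one, fun h => Theorems.AvoidanceLimit.Negative.avoidanceLimit_not_exp_half h⟩

end Summit.CriticalPhenomena.SAWScalingLimit.Cruxes.AvoidanceLimit.Birth

end
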